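import Literature.AlgebraicGeometry.Resolution.DecompositionLayerRegularity
import Literature.AlgebraicGeometry.Resolution.DecompositionLayerStrictTransforms
import Literature.AlgebraicGeometry.Resolution.DecompositionLayerZMT
import HarnessLib

/-!
# [CoP1] Prop. 9.3, decomposition layer, ASSEMBLED: `hDec` from its geometric head (Prop. 8.1 + (47))

Topic: `Literature/AlgebraicGeometry/Resolution`. PROOF side of `CossartPiltant2019ReductionP`
(`ArithmeticalThreefoldsLocal.lean`), input (C4). The hypothesis `hDec` of
`cossartPiltant2019ReductionP_of_cjs_of_stableInertiaHensel`
(`ArithmeticalThreefoldsLocalDescentInertiaHensel.lean`) is [CoP1] Prop. 9.3 for the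
decomposition layer `M ≤ K′ ≤ Kˢ`: `(LU K′) ⇒ (LU M)`. Its printed proof (HAL pp. 27–28) is

> (44) Galois approximation; "`R₁` lies dense in `R₁′`"; Prop. 8.1 applied to `R₁′`; (46);
> (47); (48)–(52); "By (52) and Zariski's Main Theorem, `R` lies below `S′`"; "`R` is regular
> since `S′` is by (45)".

This file PROVES `hDec` (for fixed frame data `S, E, O_E, M, N, K′`) from ONE hypothesis
`hHead` packaging the output of Prop. 8.1 applied to the normal local model `R₁′` of `K′`
above an arbitrary normal model `R₁` of `M`, together with (46) and the robust form of (47)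
(the non-exceptional regular parameters of `S′` are units times strict transforms of elements
of `R₁′`) — `exists_localUniformization_of_head`. Everything else is the tree:
`exists_finset_dense_locAtCentre` (density, `DecompositionLayerDensity.lean`),
`exists_radical_eq_maximalIdeal_of_dense` ((46)–(52), `DecompositionLayerStrictTransforms.lean`),
normal models (`NormalModels.lean`), `locAtCentre_le_locAtCentre_of_forall_isPrime` (ZMT,
`DecompositionLayerZMT.lean`), `exists_finset_isRegularLocalRing_of_regular` ((45),
`DecompositionLayerRegularity.lean`) and the frame lemmas (`DecompositionLayerFrame.lean`).

Everything is PROVED; no named facts, definitions, instances or notation are introduced.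

## Sources

* V. Cossart, O. Piltant, J. Algebra 320 (2008) 1051–1082: Prop. 8.1, Prop. 9.3 and its proof
  (HAL hal-00139124, pp. 22, 26–28). [CossartPiltant2008]
* V. Cossart, O. Piltant, J. Algebra 529 (2019) = arXiv:1412.0868, proof of Prop. 4.10
  (arXiv v1: Prop. 4.8, p. 54). [CossartPiltant2019]
-/

noncomputable section

open IsLocalRing Polynomial IntermediateField

namespace Literature.AlgebraicGeometry.Resolution

universe u

section Fractions

variable {S : Type u} [CommRing S] {E : Type u} [Field E] [Algebra S E]

/-- **Fraction fields of models above a model.** If `E` is algebraic over `S` (`S → E`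
injective), `T ≤ T′` are models with `T ⊆ K` and `T′` contains every element of the subfield
`K` integral over `T`, then every element of `K` is a fraction of elements of `T′` ("`R′` is a
normal local model of `K′`", [CoP1] §2.1). [cite: CossartPiltant2008, §2.1 (HAL pp. 8–9), normal local models] -/
theorem exists_div_eq_of_isIntegral_mem [Algebra.IsAlgebraic S E]
    (hinj : Function.Injective (algebraMap S E)) (T T' : Subalgebra S E) (hTT' : T ≤ T')
    (K : Subfield E) (hTK : T.toSubring ≤ K.toSubring)
    (hint : ∀ x ∈ K, IsIntegral T x → x ∈ T') {z : E} (hz : z ∈ K) :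
    ∃ a ∈ T'.toSubring, ∃ b ∈ T'.toSubring, b ≠ 0 ∧ z = a / b := by
  have hST : Function.Injective (algebraMap S T) := fun a b hab =>
    hinj (congrArg Subtype.val hab)
  have hzT : IsAlgebraic T z :=
    IsAlgebraic.extendScalars (R := S) hST (Algebra.IsAlgebraic.isAlgebraic z)
  obtain ⟨y, hy0, hyz⟩ := hzT.exists_integral_multiple
  have hyz' : IsIntegral T ((y : E) * z) := by
    rw [Algebra.smul_def] at hyz
    exact hyz
  have hyE : (y : E) ≠ 0 := fun h => hy0 (Subtype.ext h)
  have hyK : (y : E) ∈ K := hTK y.2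
  refine ⟨(y : E) * z, hint _ (K.mul_mem hyK hz) hyz', (y : E), hTT' y.2, hyE, ?_⟩
  rw [mul_div_cancel_left₀ _ hyE]

end Fractions

section Assembly

variable {S : Type u} [CommRing S] [IsDomain S] [IsRegularLocalRing S] {E : Type u} [Field E]
  [Algebra S E]

set_option maxHeartbeats 1600000 in
/-- **[CoP1] Prop. 9.3, decomposition layer (`hDec`), from its geometric head.** Frame: `S`
excellent regular local complete domain, `E` a field algebraic over `S` (`S → E` injective),
`O_E` a valuation ring of `E` dominating `S` with residue field algebraic over that of `S`;
`N | M` finite Galois inside `E` (`S ⊆ M`), `M ≤ K′ ≤ Kˢ` (the decomposition field of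
`O_E ∩ N`), and a local uniformization of `K′`. Hypothesis `hHead` (= [CoP1] Prop. 8.1 applied
to the normal local model `R₁′ = (S[t₁ ∪ t₁′])_𝔪` of `K′` above a normal model `R₁ = (S[t₁])_𝔪`
of `M`, with (46) and (47) in robust form): for every such `t₁, t₁′` there is a local
uniformization `S′ = (S[t′])_𝔪 ⊇ S[t₁ ∪ t₁′]` of `K′` with regular parameters `x₀, x₁, x₂`
(non-zero) and `0 < r ≤ 3` such that (a) `𝔪_{R₁′} S′ ⊆ (x₀⋯x_{r-1})`, (b) some `fᵢ ∈ M`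
(`i < r`) are units times monomials in `x_{<r}` with `det ≠ 0`, (c) for `r ≤ j < 3` some
`gⱼ ∈ R₁′` is `uⱼ xⱼ ∏_{i<r} xᵢ^{cⱼᵢ}`. Conclusion: `(LU M)`. Proof (HAL pp. 27–28): choose the
normal model `R₁ ∋` the Galois-approximation coefficients (density `R₁ → R₁′`,
`exists_finset_dense_locAtCentre`), take the head, build `Fᵢ, Hⱼ ∈ M ∩ 𝔪_{S′}` with
`√((F,H)S′) = 𝔪_{S′}` (`exists_radical_eq_maximalIdeal_of_dense`), replace `R₁` by the normal
model `R₂` of `M` generated over `R₁` by the `Fᵢ, Hⱼ` (inside `S′`, which is normal), so that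
`S′ = R₂′` by Zariski's Main Theorem (`locAtCentre_le_locAtCentre_of_forall_isPrime`), and
conclude that `R₂` is regular (`exists_finset_isRegularLocalRing_of_regular`, dimensions by
the dimension formula). [cite: CossartPiltant2008, Prop. 9.3 and its proof (HAL pp. 26–28)]
[cite: CossartPiltant2019, proof of Prop. 4.10 (arXiv v1: Prop. 4.8, p. 54)] -/
theorem exists_localUniformization_of_head [Algebra.IsAlgebraic S E]
    (hS : IsExcellentRing S) (hinj : Function.Injective (algebraMap S E))
    (hScomp : IsAdicComplete (maximalIdeal S) S)
    (OE : ValuationSubring E) (hSO : ∀ s : S, algebraMap S E s ∈ OE)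
    (hdom : ∀ s ∈ maximalIdeal S, OE.valuation (algebraMap S E s) < 1)
    (hres : ∀ y : OE, ∃ q : S[X], (∃ i, q.coeff i ∉ maximalIdeal S) ∧
      OE.valuation (q.eval₂ (algebraMap S E) y) < 1)
    (M : Subfield E) (hSM : ∀ s : S, algebraMap S E s ∈ M)
    (N : IntermediateField M E) [FiniteDimensional M N] [IsGalois M N] (K' : Subfield E)
    (hMK' : M ≤ K') (hK'Z : K' ≤ (lift (fixedField (decompositionGroupIn OE N))).toSubfield)
    (hLUK' : ∃ t : Finset E, (t : Set E) ⊆ K' ∧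
      K' ≤ Subfield.closure (Set.range (algebraMap S E) ∪ (t : Set E)) ∧
      ∃ hTO : (Algebra.adjoin S (t : Set E)).toSubring ≤ OE.toSubring,
        IsRegularLocalRing (Localization.AtPrime
          (Ideal.comap (Subring.inclusion hTO) (maximalIdeal OE))))
    (hHead : ∀ (t₁ : Finset E), (t₁ : Set E) ⊆ M →
        M ≤ Subfield.closure (Set.range (algebraMap S E) ∪ (t₁ : Set E)) →
        (Algebra.adjoin S (t₁ : Set E)).toSubring ≤ OE.toSubring →
        (∀ x : E, x ∈ M → IsIntegral (Algebra.adjoin S (t₁ : Set E)) x →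
          x ∈ Algebra.adjoin S (t₁ : Set E)) →
      ∀ (t₁' : Finset E), (t₁' : Set E) ⊆ K' →
        (∀ x : E, x ∈ K' → (IsIntegral (Algebra.adjoin S (t₁ : Set E)) x ↔
          x ∈ Algebra.adjoin S ((t₁ : Set E) ∪ (t₁' : Set E)))) →
      ∃ (t' : Finset E) (_ : (t' : Set E) ⊆ K')
        (hTO' : (Algebra.adjoin S (t' : Set E)).toSubring ≤ OE.toSubring)
        (_ : Algebra.adjoin S ((t₁ : Set E) ∪ (t₁' : Set E)) ≤ Algebra.adjoin S (t' : Set E))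
        (_ : IsRegularLocalRing (locAtCentre (Algebra.adjoin S (t' : Set E)).toSubring OE))
        (r : ℕ) (hr : r ≤ 3) (_ : 0 < r)
        (x : Fin 3 → locAtCentre (Algebra.adjoin S (t' : Set E)).toSubring OE),
        (∀ j, ((x j : locAtCentre (Algebra.adjoin S (t' : Set E)).toSubring OE) : E) ≠ 0) ∧
        (haveI := isLocalRing_locAtCentre hTO'
         Ideal.span (Set.range x) =
           maximalIdeal (locAtCentre (Algebra.adjoin S (t' : Set E)).toSubring OE)) ∧
        (∀ y : locAtCentre (Algebra.adjoin S (t' : Set E)).toSubring OE,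
          (y : E) ∈ locAtCentre (Algebra.adjoin S ((t₁ : Set E) ∪ (t₁' : Set E))).toSubring OE →
          OE.valuation (y : E) < 1 →
          y ∈ Ideal.span {∏ i : Fin r, x (Fin.castLE hr i)}) ∧
        (∃ (f : Fin r → E) (γ : Fin r → (locAtCentre (Algebra.adjoin S (t' : Set E)).toSubring OE)ˣ)
            (a : Matrix (Fin r) (Fin r) ℕ),
          (∀ i, f i ∈ M) ∧
          (∀ i, f i = ((γ i : locAtCentre (Algebra.adjoin S (t' : Set E)).toSubring OE) : E) *
            ∏ j, ((x (Fin.castLE hr j) :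
              locAtCentre (Algebra.adjoin S (t' : Set E)).toSubring OE) : E) ^ a i j) ∧
          (a.map (fun n : ℕ => (n : ℤ))).det ≠ 0) ∧
        (∀ j : Fin 3, r ≤ (j : ℕ) →
          ∃ (g : E) (u : (locAtCentre (Algebra.adjoin S (t' : Set E)).toSubring OE)ˣ)
            (c : Fin r → ℕ),
            g ∈ locAtCentre (Algebra.adjoin S ((t₁ : Set E) ∪ (t₁' : Set E))).toSubring OE ∧
            g = ((u : locAtCentre (Algebra.adjoin S (t' : Set E)).toSubring OE) : E) *
              ((x j : locAtCentre (Algebra.adjoin S (t' : Set E)).toSubring OE) : E) *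
              ∏ i, ((x (Fin.castLE hr i) :
                locAtCentre (Algebra.adjoin S (t' : Set E)).toSubring OE) : E) ^ c i)) :
    ∃ t : Finset E, (t : Set E) ⊆ M ∧
      M ≤ Subfield.closure (Set.range (algebraMap S E) ∪ (t : Set E)) ∧
      ∃ hTO : (Algebra.adjoin S (t : Set E)).toSubring ≤ OE.toSubring,
        IsRegularLocalRing (Localization.AtPrime
          (Ideal.comap (Subring.inclusion hTO) (maximalIdeal OE))) := by
  classical
  haveI : IsNoetherianRing S := hS.isUniversallyCatenaryRing.1
  have hSuc : IsUniversallyCatenaryRing S := hS.isUniversallyCatenaryRing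
  haveI : IsAdicComplete (maximalIdeal S) S := hScomp
  have hK'N : K' ≤ N.toSubfield := fun z hz => IntermediateField.lift_le _ (hK'Z hz)
  have hSK' : ∀ s : S, algebraMap S E s ∈ K' := fun s => hMK' (hSM s)
  have hMK's : M.toSubring ≤ K'.toSubring := fun z hz => hMK' hz
  -- `K′` as an intermediate field of `E | M`: finite and separable (it sits in `N`)
  let K'' : IntermediateField M E := K'.toIntermediateField (fun z => hMK' z.2)
  have hmemK'' : ∀ z : E, z ∈ K'' ↔ z ∈ K' := fun _ => Iff.rfl
  have hK''N : K'' ≤ N := fun z hz => hK'N ((hmemK'' z).mp hz)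
  haveI : FiniteDimensional M K'' :=
    FiniteDimensional.of_injective (IntermediateField.inclusion hK''N).toLinearMap
      (IntermediateField.inclusion_injective hK''N)
  haveI : Algebra.IsSeparable M K'' :=
    Algebra.IsSeparable.of_algHom M N (IntermediateField.inclusion hK''N)
  /- Step 1: the Galois-approximation finite sets and finite generation of `M` -/
  obtain ⟨tK, -, hK'cl, -⟩ := hLUK'
  obtain ⟨cd, hcdM, hcdO, hdenseC⟩ := exists_finset_dense_locAtCentre S E OE M hSM N
  obtain ⟨cr, hcrM, hcrO, hregC⟩ := exists_finset_isRegularLocalRing_of_regular S hS E OE M hSM N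
  obtain ⟨t₀, ht₀M, ht₀O, hMcl₀⟩ := exists_finset_le_closure_of_le hinj OE M K' hSM hMK' tK hK'cl
  /- Step 2: a normal model `S[t₁]` of `M` containing `t₀`, `cd`, `cr` -/
  have h00M : ((t₀ ∪ (cd ∪ cr) : Finset E) : Set E) ⊆ M := by
    intro z hz
    rcases Finset.mem_union.mp (Finset.mem_coe.mp hz) with h | h
    · exact ht₀M (Finset.mem_coe.mpr h)
    · rcases Finset.mem_union.mp h with h | h
      · exact hcdM (Finset.mem_coe.mpr h)
      · exact hcrM (Finset.mem_coe.mpr h)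
  have h00O : ∀ z ∈ (t₀ ∪ (cd ∪ cr) : Finset E), z ∈ OE := by
    intro z hz
    rcases Finset.mem_union.mp hz with h | h
    · exact ht₀O z h
    · rcases Finset.mem_union.mp h with h | h
      · exact hcdO z h
      · exact hcrO z h
  have hMcl00 : M ≤ Subfield.closure (Set.range (algebraMap S E) ∪
      ((t₀ ∪ (cd ∪ cr) : Finset E) : Set E)) :=
    hMcl₀.trans (Subfield.closure_mono (Set.union_subset_union_right _
      (Finset.coe_subset.mpr Finset.subset_union_left)))
  obtain ⟨t₁, h01, ht₁M, hMcl₁, ht₁O, hnorm₁⟩ :=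
    exists_normal_model S E OE hSO M hSM (t₀ ∪ (cd ∪ cr)) h00M h00O hMcl00
  set B₁ : Subalgebra S E := Algebra.adjoin S (t₁ : Set E) with hB₁def
  have hcd₁ : (cd : Set E) ⊆ B₁ := fun z hz => Algebra.subset_adjoin
    (h01 (Finset.mem_coe.mpr (Finset.mem_union_right _
      (Finset.mem_union_left _ (Finset.mem_coe.mp hz)))))
  have hcr₁ : (cr : Set E) ⊆ (t₁ : Set E) := fun z hz =>
    h01 (Finset.mem_coe.mpr (Finset.mem_union_right _
      (Finset.mem_union_right _ (Finset.mem_coe.mp hz))))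
  /- Step 3: its integral closure `S[t₁ ∪ t₁′]` in `K′` -/
  obtain ⟨t₁', ht₁'K, hint₁', hcl₁'⟩ :=
    exists_adjoin_eq_integralClosure_extension S E M hSM K'' t₁ ht₁M hMcl₁ hnorm₁
  have ht₁'K' : (t₁' : Set E) ⊆ K' := ht₁'K
  have hcl₁ : ∀ z ∈ K', IsIntegral B₁ z → z ∈ Algebra.adjoin S ((t₁ : Set E) ∪ (t₁' : Set E)) :=
    fun z hz h => hcl₁' z ((hmemK'' z).mpr hz) h
  have hext₁ : ∀ z : E, z ∈ K' →
      (IsIntegral B₁ z ↔ z ∈ Algebra.adjoin S ((t₁ : Set E) ∪ (t₁' : Set E))) :=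
    fun z hz => ⟨fun h => hcl₁ z hz h, fun h => hint₁' z h⟩
  set B₁' : Subalgebra S E := Algebra.adjoin S ((t₁ : Set E) ∪ (t₁' : Set E)) with hB₁'def
  have hB₁B₁' : B₁ ≤ B₁' := Algebra.adjoin_mono Set.subset_union_left
  have hO₁' : B₁'.toSubring ≤ OE.toSubring := fun z hz =>
    mem_valuationSubring_of_isIntegral_model B₁ OE ht₁O (hint₁' z hz)
  /- Step 4: the head (Prop. 8.1 + (46) + (47)) -/
  obtain ⟨t', ht'K', hTO', hle', hregS', hrest⟩ :=
    hHead t₁ ht₁M hMcl₁ ht₁O hnorm₁ t₁' ht₁'K' hext₁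
  set B' : Subalgebra S E := Algebra.adjoin S (t' : Set E) with hB'def
  set S' : Subring E := locAtCentre B'.toSubring OE with hS'def
  set R₁ : Subring E := locAtCentre B₁.toSubring OE with hR₁def
  set R₁' : Subring E := locAtCentre B₁'.toSubring OE with hR₁'def
  obtain ⟨r, hr, hr0, x, hx0, hxm, ha, ⟨f, γ, A, hfM, hf, hdet⟩, hg⟩ := hrest
  haveI hS'loc : IsLocalRing S' := isLocalRing_locAtCentre hTO'
  haveI hR₁'loc : IsLocalRing R₁' := isLocalRing_locAtCentre hO₁'
  have hS'O : S' ≤ OE.toSubring := locAtCentre_le hTO'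
  have h₁ : R₁' ≤ S' := locAtCentre_mono OE (fun z hz => hle' hz)
  have hSS' : ∀ s : S, algebraMap S E s ∈ S' := fun s =>
    le_locAtCentre _ _ (B'.algebraMap_mem s)
  have hB'K : B'.toSubring ≤ K'.toSubring := model_toSubring_le_of_subset hSK' ht'K'
  let MS : Subalgebra S E := { M.toSubring with algebraMap_mem' := hSM }
  have hB₁M : B₁.toSubring ≤ M.toSubring := fun z hz =>
    (Algebra.adjoin_le (S := MS) ht₁M : B₁ ≤ MS) hz
  have hR₁M : R₁ ≤ M.toSubring := locAtCentre_le_subfield _ OE M hB₁M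
  have hB₁K : B₁.toSubring ≤ K'.toSubring := hB₁M.trans hMK's
  have hfracB₁' : ∀ z ∈ K', ∃ a ∈ B₁'.toSubring, ∃ b ∈ B₁'.toSubring, b ≠ 0 ∧ z = a / b :=
    fun z hz => exists_div_eq_of_isIntegral_mem hinj B₁ B₁' hB₁B₁' K' hB₁K hcl₁ hz
  have hfracB' : ∀ z ∈ K', ∃ a ∈ B'.toSubring, ∃ b ∈ B'.toSubring, b ≠ 0 ∧ z = a / b := by
    intro z hz
    obtain ⟨a, ha, b, hb, hb0, hzab⟩ := hfracB₁' z hz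
    exact ⟨a, hle' ha, b, hle' hb, hb0, hzab⟩
  /- Step 5: (46)–(52): `Fᵢ, Hⱼ ∈ M ∩ 𝔪_{S′}` with `√((F,H)S′) = 𝔪_{S′}` -/
  have hdense : ∀ (n : ℕ) (y : E), y ∈ R₁' →
      ∃ a ∈ R₁, ∃ z : R₁', z ∈ maximalIdeal R₁' ^ n ∧ (z : E) = y - a :=
    fun n y hy => hdenseC K' hMK' hK'N hK'Z t₁ ht₁M hMcl₁ ht₁O hnorm₁ hcd₁ t₁' ht₁'K' hext₁
      hO₁' n y hy
  have ha' : ∀ z : R₁', z ∈ maximalIdeal R₁' →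
      Subring.inclusion h₁ z ∈ Ideal.span {∏ i : Fin r, x (Fin.castLE hr i)} :=
    fun z hz => ha (Subring.inclusion h₁ z) z.2 ((mem_maximalIdeal_locAtCentre_iff hO₁' z).mp hz)
  obtain ⟨D, hD, F, H, hFM, hHM, hFm, hHm, hrad⟩ :=
    exists_radical_eq_maximalIdeal_of_dense S' R₁' h₁ R₁ M hR₁M hdense hr hr0 x hx0 hxm ha'
      γ A hdet f hfM hf hg
  /- Step 6: the normal model `S[t₂] ⊇ S[t₁, F, H]` of `M`, inside `S′` -/
  let tFH : Finset E := (Finset.univ.image fun i => ((F i : S') : E)) ∪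
    (Finset.univ.image fun j => ((H j : S') : E))
  have htFH_S' : ∀ z ∈ tFH, z ∈ S' := by
    intro z hz
    rcases Finset.mem_union.mp hz with h | h
    · obtain ⟨i, -, rfl⟩ := Finset.mem_image.mp h
      exact (F i).2
    · obtain ⟨j, -, rfl⟩ := Finset.mem_image.mp h
      exact (H j).2
  have htFH_M : ∀ z ∈ tFH, z ∈ M := by
    intro z hz
    rcases Finset.mem_union.mp hz with h | h
    · obtain ⟨i, -, rfl⟩ := Finset.mem_image.mp h
      exact hFM i
    · obtain ⟨j, -, rfl⟩ := Finset.mem_image.mp h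
      exact hHM j
  let t₂pre : Finset E := t₁ ∪ tFH
  have hpreM : ((t₂pre : Finset E) : Set E) ⊆ M := by
    intro z hz
    rcases Finset.mem_union.mp (Finset.mem_coe.mp hz) with h | h
    · exact ht₁M (Finset.mem_coe.mpr h)
    · exact htFH_M z h
  have ht₁S' : (t₁ : Set E) ⊆ S' := fun z hz =>
    h₁ (le_locAtCentre _ _ (hB₁B₁' (Algebra.subset_adjoin hz)))
  have hpreS' : (Algebra.adjoin S (t₂pre : Set E)).toSubring ≤ S' := by
    refine model_toSubring_le_of_subset hSS' (fun z hz => ?_)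
    rcases Finset.mem_union.mp (Finset.mem_coe.mp hz) with h | h
    · exact ht₁S' (Finset.mem_coe.mpr h)
    · exact htFH_S' z h
  have hpreO : (Algebra.adjoin S (t₂pre : Set E)).toSubring ≤ OE.toSubring := hpreS'.trans hS'O
  have hMcl_pre : M ≤ Subfield.closure (Set.range (algebraMap S E) ∪ (t₂pre : Set E)) :=
    hMcl₁.trans (Subfield.closure_mono (Set.union_subset_union_right _
      (Finset.coe_subset.mpr Finset.subset_union_left)))
  obtain ⟨t₂, hpre₂, ht₂M, hint₂, hnorm₂⟩ :=
    exists_adjoin_isIntegrallyClosedIn S E M hSM t₂pre hpreM hMcl_pre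
  set B₂₀ : Subalgebra S E := Algebra.adjoin S (t₂ : Set E) with hB₂₀def
  have ht₂O : B₂₀.toSubring ≤ OE.toSubring :=
    model_toSubring_le_valuationSubring_of_isIntegral OE hSO _ hpreO hint₂
  letI algPre : Algebra (Algebra.adjoin S (t₂pre : Set E)) S' :=
    ((Algebra.adjoin S (t₂pre : Set E)).val.toRingHom.codRestrict S'
      (fun z => hpreS' z.2)).toAlgebra
  haveI : IsScalarTower (Algebra.adjoin S (t₂pre : Set E)) S' E :=
    IsScalarTower.of_algebraMap_eq fun _ => rfl
  have ht₂S' : B₂₀.toSubring ≤ S' := model_toSubring_le_of_subset hSS' fun z hz =>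
    mem_locAtCentre_of_isIntegral B' OE hregS' K' hB'K hfracB' (hMK' (ht₂M hz))
      (hint₂ z hz).tower_top
  have hMcl₂ : M ≤ Subfield.closure (Set.range (algebraMap S E) ∪ (t₂ : Set E)) :=
    hMcl_pre.trans (Subfield.closure_mono (Set.union_subset_union_right _ hpre₂))
  have hB₂₀K : B₂₀.toSubring ≤ K'.toSubring :=
    model_toSubring_le_of_subset hSK' (fun z hz => hMK' (ht₂M hz))
  /- Step 7: its integral closure `S[t₂ ∪ t₂′]` in `K′`, inside `S′` -/
  obtain ⟨t₂', ht₂'K, hint₂', hcl₂'⟩ :=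
    exists_adjoin_eq_integralClosure_extension S E M hSM K'' t₂ ht₂M hMcl₂ hnorm₂
  have ht₂'K' : (t₂' : Set E) ⊆ K' := ht₂'K
  have hcl₂ : ∀ z ∈ K', IsIntegral B₂₀ z → z ∈ Algebra.adjoin S ((t₂ : Set E) ∪ (t₂' : Set E)) :=
    fun z hz h => hcl₂' z ((hmemK'' z).mpr hz) h
  set B₂ : Subalgebra S E := Algebra.adjoin S ((t₂ : Set E) ∪ (t₂' : Set E)) with hB₂def
  have hB₂₀B₂ : B₂₀ ≤ B₂ := Algebra.adjoin_mono Set.subset_union_left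
  have hB₂O : B₂.toSubring ≤ OE.toSubring := fun z hz =>
    mem_valuationSubring_of_isIntegral_model B₂₀ OE ht₂O (hint₂' z hz)
  have hB₂K : B₂.toSubring ≤ K'.toSubring :=
    model_toSubring_le_of_subset hSK' (Set.union_subset (fun z hz => hMK' (ht₂M hz)) ht₂'K')
  letI alg₂ : Algebra B₂₀ S' := (B₂₀.val.toRingHom.codRestrict S' (fun z => ht₂S' z.2)).toAlgebra
  haveI : IsScalarTower B₂₀ S' E := IsScalarTower.of_algebraMap_eq fun _ => rfl
  have hB₂S' : B₂.toSubring ≤ S' := fun z hz =>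
    mem_locAtCentre_of_isIntegral B' OE hregS' K' hB'K hfracB' (hB₂K hz) (hint₂' z hz).tower_top
  have hext₂ : ∀ z : E, z ∈ K' → (IsIntegral B₂₀ z ↔ z ∈ B₂) :=
    fun z hz => ⟨fun h => hcl₂ z hz h, fun h => hint₂' z h⟩
  have hfracB₂ : ∀ z ∈ K', ∃ a ∈ B₂.toSubring, ∃ b ∈ B₂.toSubring, b ≠ 0 ∧ z = a / b :=
    fun z hz => exists_div_eq_of_isIntegral_mem hinj B₂₀ B₂ hB₂₀B₂ K' hB₂₀K hcl₂ hz
  letI alg₃ : Algebra B₂₀ B₂ := (Subalgebra.inclusion hB₂₀B₂).toAlgebra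
  haveI : IsScalarTower B₂₀ B₂ E := IsScalarTower.of_algebraMap_eq fun _ => rfl
  haveI : Algebra.IsIntegral B₂₀ B₂ := ⟨fun y =>
    (isIntegral_algHom_iff (IsScalarTower.toAlgHom B₂₀ B₂ E) Subtype.val_injective).mp
      (hint₂' y y.2)⟩
  have hnormB₂ : ∀ z ∈ K', IsIntegral B₂ z → z ∈ B₂ := fun z hz h =>
    hcl₂ z hz (isIntegral_trans z h)
  /- Step 8: "By (52) and Zariski's Main Theorem, `R` lies below `S′`": `S′ = R₂′` -/
  set R₂' : Subring E := locAtCentre B₂.toSubring OE with hR₂'def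
  have hFB₂ : ∀ i, ((F i : S') : E) ∈ B₂.toSubring := fun i =>
    hB₂₀B₂ (Algebra.subset_adjoin (hpre₂ (Finset.mem_coe.mpr (Finset.mem_union_right _
      (Finset.mem_union_left _ (Finset.mem_image.mpr ⟨i, Finset.mem_univ _, rfl⟩))))))
  have hHB₂ : ∀ j, ((H j : S') : E) ∈ B₂.toSubring := fun j =>
    hB₂₀B₂ (Algebra.subset_adjoin (hpre₂ (Finset.mem_coe.mpr (Finset.mem_union_right _
      (Finset.mem_union_right _ (Finset.mem_image.mpr ⟨j, Finset.mem_univ _, rfl⟩))))))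
  have hZMT : S' ≤ R₂' := by
    refine locAtCentre_le_locAtCentre_of_forall_isPrime OE hSO hres B₂ hB₂O t' hTO' hB₂S' K'
      hSK' ht'K' hfracB₂ hnormB₂ (fun P hP hPmem => ?_)
    have hFP : ∀ i, F i ∈ P := fun i => hPmem (F i) (le_locAtCentre _ _ (hFB₂ i))
      ((mem_maximalIdeal_locAtCentre_iff hTO' _).mp (hFm i))
    have hHP : ∀ j, H j ∈ P := fun j => hPmem (H j) (le_locAtCentre _ _ (hHB₂ j))
      ((mem_maximalIdeal_locAtCentre_iff hTO' _).mp (hHm j))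
    have hIP : Ideal.span (Set.range F ∪ Set.range H) ≤ P := by
      refine Ideal.span_le.mpr ?_
      rintro _ (⟨i, rfl⟩ | ⟨j, rfl⟩)
      · exact hFP i
      · exact hHP j
    have h1 : maximalIdeal S' ≤ P := by
      rw [← hrad, ← hP.radical]
      exact Ideal.radical_mono hIP
    exact le_antisymm (IsLocalRing.le_maximalIdeal hP.ne_top) h1
  have hR₂'S' : R₂' ≤ S' := by
    have h := locAtCentre_mono OE hB₂S'
    rwa [locAtCentre_locAtCentre] at h
  have hEq : R₂' = S' := le_antisymm hR₂'S' hZMT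
  have hregR₂' : IsRegularLocalRing R₂' := by
    rw [hEq]
    exact hregS'
  /- Step 9: "`R` is regular since `S′` is": dimensions and `exists_finset_isRegularLocalRing_of_regular` -/
  haveI : Algebra.FiniteType S B₂₀ :=
    (Subalgebra.fg_iff_finiteType _).mp (Subalgebra.fg_adjoin_finset _)
  haveI : Algebra.FiniteType S B₂ := by
    rw [hB₂def, ← Finset.coe_union]
    exact (Subalgebra.fg_iff_finiteType _).mp (Subalgebra.fg_adjoin_finset _)
  have hdim : ringKrullDim (Localization.AtPrime
      (Ideal.comap (Subring.inclusion ht₂O) (maximalIdeal OE))) = ringKrullDim R₂' := by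
    rw [ringKrullDim_localization_centre_eq_of_frame hSuc hinj OE hSO hdom hres B₂₀ ht₂O,
      hR₂'def, ringKrullDim_locAtCentre_eq_of_frame hSuc hinj OE hSO hdom hres B₂ hB₂O]
  have hcr₂ : (cr : Set E) ⊆ B₂₀ := fun z hz => Algebra.subset_adjoin
    (hpre₂ (Finset.mem_coe.mpr (Finset.mem_union_left _ (Finset.mem_coe.mp (hcr₁ hz)))))
  exact ⟨t₂, ht₂M, hMcl₂, ht₂O, hregC K' hMK' hK'N hK'Z t₂ ht₂M hMcl₂ ht₂O hnorm₂ hcr₂ t₂'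
    ht₂'K' hext₂ hB₂O hregR₂' hdim⟩

end Assembly

end Literature.AlgebraicGeometry.Resolution

end
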